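import Summits.ResolutionOfSingularities.ResolutionOfSingularities.Theorems.CurveChainCutKernels
import Literature.AlgebraicGeometry.Resolution.WeightedInitialTerms
import HarnessLib

/-!
# CurveChainCutKernels2 — decomp-res node «CurveChainCut» (lens-4 g37, critic row 209 CLEARED), tree file 2/4 of the node

Content VERBATIM from the decomp-res lens-4 g37 node `HOME/decomp-res-lens-4/g37/CurveChainCut.lean` (pin 33fe29d0;
no carry, imports the landed tree only; namespace `…Theorems.HugValuationCut`); HOME =
run/shared/lean/pub/decomp-res; critic CRITIC-LEDGER row 209 CLEARED; landing orders INBOX 10:47:47Z / :1401 —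
provenance, critic text and the lens header in full in the first file of the node, `CurveChainCutKernels`.  `--kind
proof --supports stmt-ResolutionOfSingularities-28338`.

## This file

§119b (`section CurveStalk`) STALK LEVEL: one blow-up step of the curve chain at any point of the blow-up over the
germ (`curveChain_stage_step` over `IsBlowup.exists_reesChart_stalk`; finite normalisation from the G-ring property
of the stalks, `tower_isGRing_stalk` + `module_finite_integralClosure_of_isGRing_of_ringKrullDim_eq_one`).
Continuation 2/3 of `CurveChainCutKernels` (same namespace / sections of the node, cut at the tree's 400-line cap;
section variables / opens replayed): scopes `CurveStalk` — carries `exists_seq_of_step`, `curveChain_stage_step`,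
`curveLine_step`.

[WRITER NOTE (decomp-res writer g13): file split only, at the node's own `══ FILE` markers and `section` boundaries
(tree files ≤ 400 lines); namespace, sections, section variables and every declaration exactly as in the lens; the
node's two `set_option linter.…` lines, `noncomputable section`, the namespace-level `open` lines and `universe u`
are replayed in every part (critic rider).]

(Sources: Kollar2007 §1.4 (Alg. 1.100, Thm. 1.101); CossartPiltant2008 Lemma 4.3 (3), Prop. 4.4; Matsumura1987 Thms.
14.2, 14.3, 17.8, 32.4; CossartJannsenSaito2020 §6; Hironaka1964 Ch. III; Hauser2010Kangaroo; StacksProject 07PJ / 0C4N / 032E.)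
-/

set_option linter.dupNamespace false
set_option linter.unusedSectionVars false

noncomputable section

open CategoryTheory AlgebraicGeometry IsLocalRing TopologicalSpace
open Literature.AlgebraicGeometry.Resolution
open Summit.ResolutionOfSingularities.ResolutionOfSingularities.Theorems
open WeakOrderReduction ForcedTowerClasses DivergentTowerClasses MonomialTowerClasses
open HugDimensionClasses HugDimensionKernels SurfaceShadowClasses SurfaceShadowKernels
open NearPointCut (SingularClass)
open Scheme.IdealSheafData (vanishingIdeal)
open scoped BigOperators

universe u

namespace Summit.ResolutionOfSingularities.ResolutionOfSingularities.Theorems.HugValuationCut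

section CurveStalk

/-! ### §119b stalk level: one blow-up step of the curve chain (any point of the blow-up over the germ) -/

/-! `range_fin_three` / `range_fin_two` / `range_fin_one` (`Set.range` of a `Fin 3` / `Fin 2` / `Fin 1` family) of
the lens node are, as types, ALREADY LANDED —
`Literature.AlgebraicGeometry.Resolution.range_fin_three` (`WeightedInitialTerms`, imported here and used below
under the opened namespace), `PeriodPair.range_fin_two`,
`…CleanModels.Negative.OrdWitness.range_fin_one` — so by the tree's dedup rule they are cited, not restated (writer
g13; the latter two are unused in this node). -/

/-- dependent choice along `ℕ`: a sequence through a «good» predicate with prescribed consecutive relations. [folklore] -/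
theorem exists_seq_of_step {α : ℕ → Type*} (Good : ∀ j, α j → Prop) (Rel : ∀ j, α j → α (j + 1) → Prop) (a₀ : α 0)
    (h₀ : Good 0 a₀) (step : ∀ j (a : α j), Good j a → ∃ a' : α (j + 1), Good (j + 1) a' ∧ Rel j a a') :
    ∃ f : ∀ j, α j, (∀ j, Good j (f j)) ∧ ∀ j, Rel j (f j) (f (j + 1)) := by
  let g : ∀ j, {a : α j // Good j a} := fun j =>
    Nat.rec (motive := fun j => {a : α j // Good j a}) ⟨a₀, h₀⟩
      (fun j b => ⟨Classical.choose (step j b.1 b.2), (Classical.choose_spec (step j b.1 b.2)).1⟩) j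
  refine ⟨fun j => (g j).1, fun j => (g j).2, fun j => ?_⟩
  exact (Classical.choose_spec (step j (g j).1 (g j).2)).2

/-- **ONE STEP OF THE CURVE CHAIN (δ-descent), at ANY point of the blow-up over the germ**: `σ : X' → X` the blow-up of
the reduced closed point `x = σ x'`, `𝔮 ⊂ 𝒪_{X,x}` a non-maximal prime with `dim 𝒪/𝔮 = 1` and finite normalisation,
`𝔮' ⊂ 𝒪_{X',x'}` a prime over `𝔮`; then `𝒪'/𝔮'` is one-dimensional with finite normalisation, `δ(𝒪'/𝔮') ≤ δ(𝒪/𝔮)`,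
and equality forces `𝒪/𝔮` regular — transported to a point `q = x'`.  (The stalk `𝒪_{X',x'}` is the localisation of a
Rees chart `𝒪_{X,x}[𝔪/c_j]` — Literature `IsBlowup.exists_reesChart_stalk`; `c_j ∉ 𝔮` is forced since `𝔮 ∌ 𝔪`.)
(Sources: Kollar2007, §1.4, Thm. 1.101.) -/
theorem curveChain_stage_step {X X' : Scheme.{0}} [IsLocallyNoetherian X] (σ : X' ⟶ X) (x' q : X') (h : q = x')
    (hcl : IsClosed ({σ x'} : Set X)) (hσ : IsBlowup σ (vanishingIdeal ⟨{σ x'}, hcl⟩))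
    (𝔮 : Ideal (X.presheaf.stalk (σ x'))) [𝔮.IsPrime] (h𝔮 : 𝔮 ≠ maximalIdeal _)
    (hd : ringKrullDim (X.presheaf.stalk (σ x') ⧸ 𝔮) = 1)
    (hf : Module.Finite (X.presheaf.stalk (σ x') ⧸ 𝔮)
      (integralClosure (X.presheaf.stalk (σ x') ⧸ 𝔮) (FractionRing (X.presheaf.stalk (σ x') ⧸ 𝔮))))
    (𝔮' : Ideal (X'.presheaf.stalk q)) [𝔮'.IsPrime] (h𝔮' : 𝔮'.comap (stalkMapCongr σ x' q h) = 𝔮) :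
    ringKrullDim (X'.presheaf.stalk q ⧸ 𝔮') = 1 ∧
      Module.Finite (X'.presheaf.stalk q ⧸ 𝔮')
        (integralClosure (X'.presheaf.stalk q ⧸ 𝔮') (FractionRing (X'.presheaf.stalk q ⧸ 𝔮'))) ∧
      branchDelta (X'.presheaf.stalk q) 𝔮' ≤ branchDelta (X.presheaf.stalk (σ x')) 𝔮 ∧
      (branchDelta (X'.presheaf.stalk q) 𝔮' = branchDelta (X.presheaf.stalk (σ x')) 𝔮 →
        IsRegularLocalRing (X.presheaf.stalk (σ x') ⧸ 𝔮)) := by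
  subst h
  rw [stalkMapCongr_self] at h𝔮'
  -- generators of `𝔪_x` and the Rees chart containing `𝒪_{X',q}`
  obtain ⟨n, c, hc⟩ := Submodule.fg_iff_exists_fin_generating_family.mp
    (IsNoetherian.noetherian (maximalIdeal (X.presheaf.stalk (σ q))))
  have hc' : Ideal.span (Set.range c) = stalkIdeal (vanishingIdeal ⟨{σ q}, hcl⟩) (σ q) := by
    rw [stalkIdeal_vanishingIdeal_singleton hcl]; exact hc
  obtain ⟨j, 𝔴, χ, hχ, hloc, h𝔴⟩ := hσ.exists_reesChart_stalk q c hc'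
  letI := χ.toAlgebra
  haveI : IsLocalization.AtPrime (X'.presheaf.stalk q) 𝔴.asIdeal := hloc
  -- `c_j ∉ 𝔮`
  have hq : c j ∉ 𝔮 := by
    intro hcj
    have hj' : χ (chartBase c j (c j)) ∈ 𝔮' := by
      rw [hχ]; rw [← h𝔮'] at hcj; exact hcj
    have hle : maximalIdeal (X.presheaf.stalk (σ q)) ≤ 𝔮 := by
      rw [← show Ideal.span (Set.range c) = maximalIdeal _ from hc, Ideal.span_le]
      rintro _ ⟨l, rfl⟩
      rw [SetLike.mem_coe, ← h𝔮', Ideal.mem_comap, ← hχ, reesChartBase_apply_eq_mul_chartGen c j l, map_mul]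
      exact Ideal.mul_mem_right _ _ hj'
    exact h𝔮 ((IsLocalRing.maximalIdeal.isMaximal _).eq_of_le (Ideal.IsPrime.ne_top ‹𝔮.IsPrime›) hle).symm
  -- the contraction of `𝔮'` to the chart is the strict transform `ker θ_{𝔮,j}`
  have hPq : (𝔮'.comap χ).comap (chartBase c j) = 𝔮 := by
    rw [Ideal.comap_comap, show χ.comp (chartBase c j) = (σ.stalkMap q).hom from RingHom.ext hχ, h𝔮']
  have hQ : 𝔮'.comap (algebraMap (chartRing c j) (X'.presheaf.stalk q)) = RingHom.ker (chartBranchMap c j 𝔮 hq) := by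
    rw [RingHom.algebraMap_toAlgebra]; exact eq_ker_chartBranchMap c j 𝔮 hq _ hPq
  exact curveBranch_step c hc j 𝔴.asIdeal h𝔴 (X'.presheaf.stalk q) 𝔮 hd hf hq 𝔮' hQ

set_option maxHeartbeats 400000 in
/-- **ONE STEP OF THE LINE BRIDGE**: `σ : X' → X` the blow-up of the reduced closed point `x = σ x'` of a regular
threefold germ, `(u; y₂, y₃)` generators of `𝔪_x` with `y₂, y₃ ∈ 𝔮`, `𝔮 ≠ 𝔪_x` a prime, `𝔮' ⊂ 𝒪_{X',x'}` a prime over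
`𝔮`; then the chart at `x'` is the `u`-chart, `x'` is its origin, and `(u' = σ^# u; y₂' = y₂/u, y₃' = y₃/u)` generate
`𝔪_{x'}` with `σ^# y_l = u' y_l'` and `y_l' ∈ 𝔮'` — transported to a point `q = x'`. (Sources: CossartPiltant2008,
Lemma 4.3 (3); Matsumura1987, Thm. 14.2.) -/
theorem curveLine_step {X X' : Scheme.{0}} (σ : X' ⟶ X) (x' q : X') (h : q = x')
    (hcl : IsClosed ({σ x'} : Set X)) (hσ : IsBlowup σ (vanishingIdeal ⟨{σ x'}, hcl⟩))
    [IsRegularLocalRing (X.presheaf.stalk (σ x'))] (hd : (maximalIdeal (X.presheaf.stalk (σ x'))).spanFinrank = 3)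
    (𝔮 : Ideal (X.presheaf.stalk (σ x'))) [𝔮.IsPrime] (h𝔮 : 𝔮 ≠ maximalIdeal _)
    (𝔮' : Ideal (X'.presheaf.stalk q)) [𝔮'.IsPrime] (h𝔮' : 𝔮'.comap (stalkMapCongr σ x' q h) = 𝔮)
    {u y₂ y₃ : X.presheaf.stalk (σ x')} (hgen : Ideal.span {u, y₂, y₃} = maximalIdeal _) (hy₂ : y₂ ∈ 𝔮)
    (hy₃ : y₃ ∈ 𝔮) :
    ∃ u' y₂' y₃' : X'.presheaf.stalk q, Ideal.span {u', y₂', y₃'} = maximalIdeal _ ∧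
      stalkMapCongr σ x' q h u = u' ∧ stalkMapCongr σ x' q h y₂ = u' * y₂' ∧ stalkMapCongr σ x' q h y₃ = u' * y₃' ∧
      y₂' ∈ 𝔮' ∧ y₃' ∈ 𝔮' := by
  subst h
  rw [stalkMapCongr_self] at h𝔮' ⊢
  classical
  set c : Fin 3 → X.presheaf.stalk (σ q) := ![u, y₂, y₃] with hcdef
  have hc0 : c 0 = u := rfl
  have hc1 : c 1 = y₂ := rfl
  have hc2 : c 2 = y₃ := rfl
  have hc : Ideal.span (Set.range c) = maximalIdeal _ := by rw [range_fin_three, hc0, hc1, hc2, hgen]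
  have hc' : Ideal.span (Set.range c) = stalkIdeal (vanishingIdeal ⟨{σ q}, hcl⟩) (σ q) := by
    rw [stalkIdeal_vanishingIdeal_singleton hcl]; exact hc
  obtain ⟨j, 𝔴, χ, hχ, hloc, h𝔴⟩ := hσ.exists_reesChart_stalk q c hc'
  letI := χ.toAlgebra
  haveI : IsLocalization.AtPrime (X'.presheaf.stalk q) 𝔴.asIdeal := hloc
  -- `u ∉ 𝔮`
  have hu : u ∉ 𝔮 := by
    intro hu
    have hle : maximalIdeal (X.presheaf.stalk (σ q)) ≤ 𝔮 := by
      rw [← hgen, Ideal.span_le]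
      rintro z hz
      simp only [Set.mem_insert_iff, Set.mem_singleton_iff] at hz
      rcases hz with rfl | rfl | rfl
      exacts [hu, hy₂, hy₃]
    exact h𝔮 ((IsLocalRing.maximalIdeal.isMaximal _).eq_of_le (Ideal.IsPrime.ne_top ‹𝔮.IsPrime›) hle).symm
  have hmem : ∀ l : Fin 3, l ≠ 0 → c l ∈ 𝔮 := by
    intro l hl
    fin_cases l
    · exact absurd rfl hl
    · exact hy₂
    · exact hy₃
  -- the chart is the `u`-chart
  obtain rfl : j = 0 := by
    by_contra hj
    have hj' : χ (chartBase c j (c j)) ∈ 𝔮' := by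
      rw [hχ]; have := hmem j hj; rw [← h𝔮'] at this; exact this
    apply hu
    rw [← h𝔮', Ideal.mem_comap, ← hc0, ← hχ, reesChartBase_apply_eq_mul_chartGen c j 0, map_mul]
    exact Ideal.mul_mem_right _ _ hj'
  -- `y_l' = e_l ∈ 𝔮'`: `u' · e_l = σ^# y_l ∈ 𝔮'` and `u' ∉ 𝔮'`
  have hu' : (σ.stalkMap q).hom u ∉ 𝔮' := fun h' => hu (by rw [← h𝔮']; exact h')
  have key : ∀ l : Fin 3, l ≠ 0 → χ (chartGen c 0 l) ∈ 𝔮' := by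
    intro l hl
    have h1 : (σ.stalkMap q).hom (c l) ∈ 𝔮' := by have := hmem l hl; rw [← h𝔮'] at this; exact this
    rw [← hχ, reesChartBase_apply_eq_mul_chartGen c 0 l, map_mul, hχ] at h1
    exact (Ideal.IsPrime.mem_or_mem ‹𝔮'.IsPrime› h1).resolve_left hu'
  -- `q` is the origin of the `u`-chart and `(u', e₁, e₂)` is its regular system of parameters
  have he : ∀ l : Fin 3, l ≠ 0 → chartGen c 0 l ∈ 𝔴.asIdeal := by
    intro l hl
    rw [← IsLocalization.AtPrime.under_maximalIdeal (X'.presheaf.stalk q) 𝔴.asIdeal, Ideal.under_def,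
      Ideal.mem_comap, RingHom.algebraMap_toAlgebra]
    exact IsLocalRing.le_maximalIdeal (Ideal.IsPrime.ne_top ‹𝔮'.IsPrime›) (key l hl)
  have hspan := (isRegularLocalRing_and_span_originFamily hd c hc 0 𝔴.asIdeal h𝔴 he (X'.presheaf.stalk q)).2.2
  rw [range_fin_three, originFamily_self, originFamily_of_ne c 0 _ (show (1 : Fin 3) ≠ 0 by decide),
    originFamily_of_ne c 0 _ (show (2 : Fin 3) ≠ 0 by decide), RingHom.algebraMap_toAlgebra, hχ] at hspan
  have hrel : ∀ l : Fin 3, (σ.stalkMap q).hom (c l) = (σ.stalkMap q).hom (c 0) * χ (chartGen c 0 l) := by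
    intro l
    have e := hχ (c l)
    rw [reesChartBase_apply_eq_mul_chartGen c 0 l, map_mul, hχ] at e
    exact e.symm
  exact ⟨(σ.stalkMap q).hom u, χ (chartGen c 0 1), χ (chartGen c 0 2), hspan, rfl, hrel 1, hrel 2,
    key 1 (by decide), key 2 (by decide)⟩

end CurveStalk

end Summit.ResolutionOfSingularities.ResolutionOfSingularities.Theorems.HugValuationCut
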